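import Summits.SmoothPoincare4.SmoothPoincare4.Theorems.ConvexBisectionAcyclicBisectionExistsOrseamFrame
import Summits.SmoothPoincare4.SmoothPoincare4.Theorems.ConvexBisectionAcyclicBisectionExistsBeltFramingFamilies
import Literature.Geometry.Symplectic.TwoHandleIsotopyProofs
import Literature.Topology.FourManifolds.CorkDecomposition
import HarnessLib

/-!
# Dual handles, ORSEAM: corresponding frames at a seam point and positive frames of the cap
(sub-goal ORSEAM of stub `stub_T3_dualPresentation` (T3), line `modp-braid-orbits` r12, crux
`ConvexBisection.AcyclicBisectionExists`, item stmt-SmoothPoincare4-10508; wave 5, lead c5, worker X4;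
registered sub-goal `helper_exists_seamFrames`)

Sequel of `…OrseamFrame.lean` (`det4` calculus, `ambientC = ambient`, the frame flip under
`σ = baseReflection g`).  T3 clause (iv) (ORSEAM) needs, at one seam point `b₁.incl y₀ = D₁.jA a₁`,
`b₂.incl (φ y₀) = D₂.jA a₂`, a frame `uu` of `T_{y₀} ∂X₁` and frames `v₁`, `v₂` of the cap at `a₁`, `a₂`
with `d(b₁.incl) uu = d(D₁.jA) v₁`, `d(b₂.incl ∘ φ) uu = d(D₂.jA) v₂`, both positively oriented.  Here the
EXISTENCE of corresponding frames (the signs are the business of `…OrseamSignPin.lean`):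

* §1 boundary calculus: every boundary datum factors through the canonical one
  (`b.incl = incl_{∂X} ∘ ∂(id)`, `restrictDiffeomorph`), so `d(b.incl) = (0, ·) ∘ d(∂(id))` and every
  vector tangent to `∂X` at `b.incl y` is `d(b.incl)_y u` for some `u` (`exists_mfderiv_incl_eq`);
  `d(jA)` of multi-attachment data is onto (an injective endomorphism of `ℝ⁴`) and reflects tangency
  to the boundary (`mem_boundaryTangentSpace_of_mfderiv_jA`).
* §2 `exists_seamFrames` (registered as `helper_exists_seamFrames`): every tangent frame `v₁` at `a₁`
  has corresponding frames `uu`, `v₂` (`v₂` tangent); `det4_ne_zero_of_normal_frame` and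
  `exists_isPosBdryFrame`: every unsurgered boundary point of the cap carries a POSITIVE tangent frame
  (`e₁, e₂, e₃` or `e₂, e₁, e₃`).

Everything is proved; no named facts, no `sorry`.

## References
* J. M. Lee, *Introduction to Smooth Manifolds* (2013), Thm. 5.11 (the boundary as an embedded
  submanifold), Prop. 15.24 (boundary orientation). [LeeSmoothManifolds2013]
* R. İ. Baykur, *Kähler decomposition of 4-manifolds*, AGT 6 (2006), proof of Thm. 5.1. [Baykur2006]
-/

noncomputable section

-- the prescribed namespace `Summit.<P>.<Sub>.…` duplicates `SmoothPoincare4` (P = Sub)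
set_option linter.dupNamespace false

open scoped Manifold ContDiff Topology RealInnerProductSpace

namespace Summit.SmoothPoincare4.SmoothPoincare4.Theorems.AcyclicBisectionExists.ModpBraidOrbits

open Set Function Metric Module
open Literature.Topology.FourManifolds Literature.Topology.FourManifolds.HandleAttachingMap
  Literature.Topology.FourManifolds.BoundaryManifold Literature.Topology.FourManifolds.LefschetzBase
  Literature.Geometry.Symplectic Literature.Geometry.Manifold

/-! ## §1 Boundary calculus: lifting tangent vectors through `b.incl` and `jA` -/

section BoundaryCalc

variable {X : Type*} [TopologicalSpace X] [ChartedSpace (EuclideanHalfSpace 4) X] [IsManifold (𝓡∂ 4) ∞ X]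

/-- **Any boundary datum factors through the canonical one**: `b.incl = incl_{∂X} ∘ ∂(id)` with
`∂(id) = b.restrictDiffeomorph (boundaryData 3 X) (refl)`. [cite: LeeSmoothManifolds2013, Thm. 5.11] -/
theorem incl_eq_comp_restrictDiffeomorph (b : BoundaryData (𝓡∂ 4) X (𝓡 3)) :
    b.incl = (BoundaryManifold.boundaryData 3 X).incl ∘
      b.restrictDiffeomorph (BoundaryManifold.boundaryData 3 X) (Diffeomorph.refl (𝓡∂ 4) X ∞) := by
  funext z
  rw [comp_apply, BoundaryData.incl_restrictDiffeomorph, Diffeomorph.coe_refl, id]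

/-- **The differential of any boundary inclusion** is `(0, ·) ∘ d(∂(id))`. [cite: LeeSmoothManifolds2013, Thm. 5.11] -/
theorem hasMFDerivAt_incl_boundaryData' (b : BoundaryData (𝓡∂ 4) X (𝓡 3)) (y : b.carrier) :
    HasMFDerivAt (𝓡 3) (𝓡∂ 4) b.incl y ((consZeroL 3).comp
      (mfderiv (𝓡 3) (𝓡 3) (b.restrictDiffeomorph (BoundaryManifold.boundaryData 3 X)
        (Diffeomorph.refl (𝓡∂ 4) X ∞)) y)) := by
  set R := b.restrictDiffeomorph (BoundaryManifold.boundaryData 3 X) (Diffeomorph.refl (𝓡∂ 4) X ∞)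
  have hR : MDifferentiableAt (𝓡 3) (𝓡 3) R y := R.contMDiff.mdifferentiableAt (by simp)
  rw [incl_eq_comp_restrictDiffeomorph b]
  exact (hasMFDerivAt_incl_boundaryData (n := 3) (R y)).comp y hR.hasMFDerivAt

/-- Images of `d(b.incl)` are tangent to the boundary: their `0`-th chart coordinate vanishes. [folklore] -/
theorem mfderiv_incl_mem_boundaryTangentSpace (b : BoundaryData (𝓡∂ 4) X (𝓡 3)) (y : b.carrier)
    (u : EuclideanSpace ℝ (Fin 3)) : mfderiv (𝓡 3) (𝓡∂ 4) b.incl y u ∈ boundaryTangentSpace := by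
  refine (mem_boundaryTangentSpace_iff _).2 ?_
  rw [(hasMFDerivAt_incl_boundaryData' b y).mfderiv]
  exact consZeroL_apply_zero _

/-- **Every vector tangent to `∂X` at `b.incl y` is the image of a vector of `T_y` under `d(b.incl)`.**
[cite: LeeSmoothManifolds2013, Thm. 5.11] -/
theorem exists_mfderiv_incl_eq (b : BoundaryData (𝓡∂ 4) X (𝓡 3)) (y : b.carrier)
    {V : EuclideanSpace ℝ (Fin 4)} (hV : V 0 = 0) :
    ∃ u : EuclideanSpace ℝ (Fin 3), mfderiv (𝓡 3) (𝓡∂ 4) b.incl y u = V := by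
  set R := b.restrictDiffeomorph (BoundaryManifold.boundaryData 3 X) (Diffeomorph.refl (𝓡∂ 4) X ∞)
  set E := R.mfderivToContinuousLinearEquiv (by simp) y with hE
  refine ⟨E.symm (tail 3 V), ?_⟩
  rw [(hasMFDerivAt_incl_boundaryData' b y).mfderiv]
  have h1 : (mfderiv (𝓡 3) (𝓡 3) R y) (E.symm (tail 3 V)) = tail 3 V := E.apply_symm_apply _
  show consZeroL 3 ((mfderiv (𝓡 3) (𝓡 3) R y) (E.symm (tail 3 V))) = V
  rw [h1]
  exact consCLE_tail_of_eq_zero 3 hV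

end BoundaryCalc

section JA

variable {M : Type*} [TopologicalSpace M] [T2Space M] [ChartedSpace (EuclideanHalfSpace 4) M]
  [IsManifold (𝓡∂ 4) ∞ M] {ι : Type*} [Finite ι] {h : ι → HandleAttachingMap 3 2 M}
  {P : Type*} [TopologicalSpace P] [ChartedSpace (EuclideanHalfSpace 4) P] [IsManifold (𝓡∂ 4) ∞ P]

/-- **`d(jA)` is onto** (an injective endomorphism of `ℝ⁴`). [folklore] -/
theorem surjective_mfderiv_jA (D : MultiAttachmentData h (𝓡∂ 4) P) (a : ↥(coresComplement h)) :
    Surjective (mfderiv (𝓡∂ 4) (𝓡∂ 4) D.jA a) := by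
  set L : EuclideanSpace ℝ (Fin 4) →L[ℝ] EuclideanSpace ℝ (Fin 4) := mfderiv (𝓡∂ 4) (𝓡∂ 4) D.jA a with hL
  have hinj : Injective L := injective_mfderiv_jA D a
  have : Surjective (L : EuclideanSpace ℝ (Fin 4) →ₗ[ℝ] EuclideanSpace ℝ (Fin 4)) :=
    LinearMap.injective_iff_surjective.1 hinj
  exact this

/-- **`d(jA)` reflects tangency to the boundary** at boundary points: if `d(jA)_a v` is tangent to
`∂P` then `v` is tangent to `∂M` (`d(jA)` maps the boundary hyperplane injectively, hence onto,
itself). [folklore] -/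
theorem mem_boundaryTangentSpace_of_mfderiv_jA (D : MultiAttachmentData h (𝓡∂ 4) P)
    (a : ↥(coresComplement h)) (ha : (𝓡∂ 4).IsBoundaryPoint (a : M)) {v : EuclideanSpace ℝ (Fin 4)}
    (hv : mfderiv (𝓡∂ 4) (𝓡∂ 4) D.jA a v ∈ boundaryTangentSpace) : v ∈ boundaryTangentSpace := by
  set L : EuclideanSpace ℝ (Fin 4) →L[ℝ] EuclideanSpace ℝ (Fin 4) := mfderiv (𝓡∂ 4) (𝓡∂ 4) D.jA a with hL
  have hinj : Injective L := injective_mfderiv_jA D a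
  have hmaps : ∀ x ∈ boundaryTangentSpace, (L : EuclideanSpace ℝ (Fin 4) →ₗ[ℝ] EuclideanSpace ℝ (Fin 4)) x ∈
      boundaryTangentSpace := fun x hx => mfderiv_jA_mem_boundaryTangentSpace D a ha hx
  set G := (L : EuclideanSpace ℝ (Fin 4) →ₗ[ℝ] EuclideanSpace ℝ (Fin 4)).restrict hmaps with hG
  have hGinj : Injective G := fun x y hxy => by
    apply Subtype.ext
    apply hinj
    have := congrArg Subtype.val hxy
    simpa [hG] using this
  have hGsurj : Surjective G := LinearMap.injective_iff_surjective.1 hGinj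
  obtain ⟨x, hx⟩ := hGsurj ⟨L v, hv⟩
  have hx' : L x = L v := by
    have := congrArg Subtype.val hx
    simpa [hG] using this
  rw [← hinj hx']
  exact x.2

end JA

/-! ## §2 Corresponding frames at a seam point; positive frames -/

section Frames

variable {g : ℕ}
  {X₁ : Type*} [TopologicalSpace X₁] [ChartedSpace (EuclideanHalfSpace 4) X₁]
  [IsManifold (𝓡∂ 4) ∞ X₁] {ι₁ : Type*} [Finite ι₁] {q₁ : ι₁ → HandleAttachingMap 3 2 (Base g)}
  {W₂ : Type*} [TopologicalSpace W₂] [ChartedSpace (EuclideanHalfSpace 4) W₂]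
  [IsManifold (𝓡∂ 4) ∞ W₂] {ι₂ : Type*} [Finite ι₂] {q₂ : ι₂ → HandleAttachingMap 3 2 (Base g)}

/-- A point of the cap read on the seam is a boundary point: `b.incl y = D.jA a ⇒ rho a = 1/4`.
[folklore] -/
theorem rho_eq_of_incl_eq_jA {X : Type*} [TopologicalSpace X] [ChartedSpace (EuclideanHalfSpace 4) X]
    [IsManifold (𝓡∂ 4) ∞ X] {ι : Type*} [Finite ι] {q : ι → HandleAttachingMap 3 2 (Base g)}
    (D : MultiAttachmentData q (𝓡∂ 4) X) (b : BoundaryData (𝓡∂ 4) X (𝓡 3)) {y : b.carrier}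
    {a : ↥(coresComplement q)} (hy : b.incl y = D.jA a) :
    (𝓡∂ 4).IsBoundaryPoint (a : Base g) ∧ rho g (a : Base g).1 = 1 / 4 := by
  have h1 : (𝓡∂ 4).IsBoundaryPoint (D.jA a) := by
    rw [← hy]; exact b.incl_mem_boundary y
  have h2 := (isBoundaryPoint_jA_iff D a).1 h1
  exact ⟨h2, (RegularSublevel.mem_boundary_iff (isRegularLevel_rho g) _).1 h2⟩

/-- **Corresponding frames at a seam point.**  At `b₁.incl y₀ = D₁.jA a₁`, `b₂.incl (φ y₀) = D₂.jA a₂`,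
every tangent frame `v₁` at `a₁` is `d(D₁.jA)⁻¹ d(b₁.incl)` of a frame `uu` of `T_{y₀}`, which
`d(D₂.jA)⁻¹ d(b₂.incl ∘ φ)` carries to a tangent frame `v₂` at `a₂`. [cite: LeeSmoothManifolds2013, Thm. 5.11] -/
theorem exists_seamFrames (D₁ : MultiAttachmentData q₁ (𝓡∂ 4) X₁) (b₁ : BoundaryData (𝓡∂ 4) X₁ (𝓡 3))
    (D₂ : MultiAttachmentData q₂ (𝓡∂ 4) W₂) (b₂ : BoundaryData (𝓡∂ 4) W₂ (𝓡 3))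
    (φ : b₁.carrier ≃ₘ⟮𝓡 3, 𝓡 3⟯ b₂.carrier) (y₀ : b₁.carrier) (a₁ : ↥(coresComplement q₁))
    (a₂ : ↥(coresComplement q₂)) (h₁ : b₁.incl y₀ = D₁.jA a₁) (h₂ : b₂.incl (φ y₀) = D₂.jA a₂)
    (v₁ : Fin 3 → EuclideanSpace ℝ (Fin 4)) (hv₁ : ∀ k, v₁ k 0 = 0) :
    ∃ (uu : Fin 3 → EuclideanSpace ℝ (Fin 3)) (v₂ : Fin 3 → EuclideanSpace ℝ (Fin 4)),
      (∀ k, mfderiv (𝓡 3) (𝓡∂ 4) b₁.incl y₀ (uu k) = mfderiv (𝓡∂ 4) (𝓡∂ 4) D₁.jA a₁ (v₁ k)) ∧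
      (∀ k, mfderiv (𝓡 3) (𝓡∂ 4) (b₂.incl ∘ φ) y₀ (uu k) = mfderiv (𝓡∂ 4) (𝓡∂ 4) D₂.jA a₂ (v₂ k)) ∧
      (∀ k, v₂ k 0 = 0) := by
  have ha₁ := (rho_eq_of_incl_eq_jA D₁ b₁ h₁).1
  have ha₂ := (rho_eq_of_incl_eq_jA D₂ b₂ h₂).1
  -- side 1: lift `d(jA) v₁` through `d(b₁.incl)`
  have hU : ∀ k, mfderiv (𝓡∂ 4) (𝓡∂ 4) D₁.jA a₁ (v₁ k) ∈ boundaryTangentSpace := fun k =>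
    mfderiv_jA_mem_boundaryTangentSpace D₁ a₁ ha₁ ((mem_boundaryTangentSpace_iff _).2 (hv₁ k))
  have huu : ∀ k, ∃ u : EuclideanSpace ℝ (Fin 3),
      mfderiv (𝓡 3) (𝓡∂ 4) b₁.incl y₀ u = mfderiv (𝓡∂ 4) (𝓡∂ 4) D₁.jA a₁ (v₁ k) := fun k =>
    exists_mfderiv_incl_eq b₁ y₀ ((mem_boundaryTangentSpace_iff _).1 (hU k))
  choose uu huu using huu
  -- side 2: push through `d(b₂.incl ∘ φ)` and lift through `d(jA)`
  have hφ : MDifferentiableAt (𝓡 3) (𝓡 3) φ y₀ := φ.contMDiff.mdifferentiableAt (by simp)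
  have hb₂ : MDifferentiableAt (𝓡 3) (𝓡∂ 4) b₂.incl (φ y₀) :=
    (b₂.isSmoothEmbedding.contMDiff (φ y₀)).mdifferentiableAt (by simp)
  have hZ0 : ∀ k, mfderiv (𝓡 3) (𝓡∂ 4) (b₂.incl ∘ φ) y₀ (uu k) ∈ boundaryTangentSpace := fun k => by
    rw [mfderiv_comp y₀ hb₂ hφ]
    exact mfderiv_incl_mem_boundaryTangentSpace b₂ (φ y₀) _
  have hv₂ : ∀ k, ∃ v : EuclideanSpace ℝ (Fin 4),
      mfderiv (𝓡∂ 4) (𝓡∂ 4) D₂.jA a₂ v = mfderiv (𝓡 3) (𝓡∂ 4) (b₂.incl ∘ φ) y₀ (uu k) := fun k =>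
    surjective_mfderiv_jA D₂ a₂ _
  choose v₂ hv₂ using hv₂
  refine ⟨uu, v₂, huu, fun k => (hv₂ k).symm, fun k => ?_⟩
  exact (mem_boundaryTangentSpace_iff _).1 (mem_boundaryTangentSpace_of_mfderiv_jA D₂ a₂ ha₂
    (by rw [hv₂ k]; exact hZ0 k))

/-- **A normal and an independent frame of its hyperplane have non-zero `det4`.** [folklore] -/
theorem det4_ne_zero_of_normal_frame (n : EuclideanSpace ℝ (Fin 4)) (V : Fin 3 → EuclideanSpace ℝ (Fin 4))
    (hn : n ≠ 0) (hV : ∀ k, ⟪n, V k⟫ = 0) (hli : LinearIndependent ℝ V) :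
    det4 n (V 0) (V 1) (V 2) ≠ 0 := by
  set w : Fin 4 → EuclideanSpace ℝ (Fin 4) := ![n, V 0, V 1, V 2] with hw
  have hli4 : LinearIndependent ℝ w := by
    rw [Fintype.linearIndependent_iff]
    intro c hc
    have hsum : ∑ i, c i • w i = c 0 • n + (c 1 • V 0 + c 2 • V 1 + c 3 • V 2) := by
      rw [Fin.sum_univ_four]; simp only [hw, Matrix.cons_val_zero, Matrix.cons_val_one, Matrix.cons_val]; abel
    have h0 : c 0 = 0 := by
      have := congrArg (fun x => ⟪n, x⟫) hc
      simp only [hsum, inner_add_right, real_inner_smul_right, hV, mul_zero, add_zero, inner_zero_right,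
        real_inner_self_eq_norm_sq] at this
      rcases mul_eq_zero.1 this with h | h
      · exact h
      · exact absurd (pow_eq_zero_iff two_ne_zero |>.1 h) (norm_ne_zero_iff.2 hn)
    have hrest : ∑ k : Fin 3, (c k.succ) • V k = 0 := by
      rw [Fin.sum_univ_three]
      have : c 1 • V 0 + c 2 • V 1 + c 3 • V 2 = 0 := by
        rw [hsum, h0, zero_smul, zero_add] at hc; exact hc
      simpa using this
    have hc' := (Fintype.linearIndependent_iff.1 hli) (fun k => c k.succ) hrest
    intro i
    fin_cases i
    · exact h0
    · exact hc' 0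
    · exact hc' 1
    · exact hc' 2
  have hspan : Submodule.span ℝ (Set.range w) = ⊤ :=
    hli4.span_eq_top_of_card_eq_finrank' (by simp)
  have hunit := ((PiLp.basisFun 2 ℝ (Fin 4)).is_basis_iff_det).1 ⟨hli4, hspan⟩
  rw [det4_eq_basis_det]
  exact hunit.ne_zero

/-- **Every unsurgered boundary point of the cap carries a POSITIVE tangent frame** (chart vectors
`e₁, e₂, e₃` of the boundary hyperplane, or `e₂, e₁, e₃`). [cite: LeeSmoothManifolds2013, Prop. 15.24] -/
theorem exists_isPosBdryFrame (q : ι₁ → HandleAttachingMap 3 2 (Base g)) (a : ↥(coresComplement q))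
    (ha : rho g (a : Base g).1 = 1 / 4) :
    ∃ v : Fin 3 → EuclideanSpace ℝ (Fin 4), (∀ k, v k 0 = 0) ∧ IsPosBdryFrame q a v := by
  set e : Fin 3 → EuclideanSpace ℝ (Fin 4) := fun k => EuclideanSpace.single k.succ (1 : ℝ) with he
  have he0 : ∀ k, e k 0 = 0 := fun k => by
    rw [he]; simp only [PiLp.single_apply]; rw [if_neg (Fin.succ_ne_zero k).symm]
  set n := gradient (rho g) (a : Base g).1 with hn
  set V : Fin 3 → EuclideanSpace ℝ (Fin 4) := fun k => ambient g (a : Base g) (e k) with hV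
  have hVn : ∀ k, ⟪n, V k⟫ = 0 := fun k => by
    rw [hn, inner_gradient_eq_fderiv, hV]
    show fderiv ℝ (rho g) (a : Base g).1 (ambient g (a : Base g) (e k)) = 0
    rw [fderiv_rho_ambient _ ha, he0, neg_zero]
  have hli : LinearIndependent ℝ V := by
    rw [Fintype.linearIndependent_iff]
    intro c hc
    have hadd : ∀ x y : EuclideanSpace ℝ (Fin 4), ambient g (a : Base g) (x + y) =
        ambient g (a : Base g) x + ambient g (a : Base g) y := fun x y =>
      (mfderiv (𝓡∂ 4) (𝓡 4) (RegularSublevel.incl (isRegularLevel_rho g)) (a : Base g)).map_add x y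
    have hlin : ambient g (a : Base g) (∑ k, c k • e k) = ∑ k, c k • ambient g (a : Base g) (e k) := by
      simp only [Fin.sum_univ_three, hadd, ambient_smul]
    have h1 : ambient g (a : Base g) (∑ k, c k • e k) = 0 := by rw [hlin]; exact hc
    have h0 : ambient g (a : Base g) 0 = 0 := by unfold ambient; exact map_zero _
    have h2 : ∑ k, c k • e k = 0 := injective_ambient (a : Base g) (by rw [h1, h0])
    intro k
    have := congrArg (fun x : EuclideanSpace ℝ (Fin 4) => x k.succ) h2
    simp only [Fin.sum_univ_three, he, PiLp.add_apply, PiLp.smul_apply, PiLp.single_apply, smul_eq_mul,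
      PiLp.zero_apply, Fin.succ_inj] at this
    fin_cases k <;> simpa using this
  have hD : det4 n (V 0) (V 1) (V 2) ≠ 0 :=
    det4_ne_zero_of_normal_frame n V (gradient_rho_ne_zero (a : Base g) ha) hVn hli
  have hamb : ∀ k, ambientC q a (e k) = V k := fun k => ambientC_eq_ambient q a (e k)
  rcases lt_or_gt_of_ne hD with hlt | hgt
  · refine ⟨![e 1, e 0, e 2], fun k => by fin_cases k <;> exact he0 _, ?_⟩
    unfold IsPosBdryFrame
    simp only [Matrix.cons_val_zero, Matrix.cons_val_one, Matrix.cons_val, hamb]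
    have hswap : det4 n (V 1) (V 0) (V 2) = -det4 n (V 0) (V 1) (V 2) := by
      rw [det4_eq_basis_det, det4_eq_basis_det]
      have := AlternatingMap.map_swap ((PiLp.basisFun 2 ℝ (Fin 4)).det) ![n, V 0, V 1, V 2]
        (show (1 : Fin 4) ≠ 2 by decide)
      rw [← this]
      congr 1
      funext i; fin_cases i <;> rfl
    rw [hswap]
    linarith
  · exact ⟨e, he0, by unfold IsPosBdryFrame; simp only [hamb]; exact hgt⟩

end Frames

/-! ## §3 The registered package -/

/-- **Sub-goal `helper_exists_seamFrames` of stub `stub_T3_dualPresentation`** (T3 ▸ ORSEAM; wave 5,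
lead c5, worker X4): **corresponding frames at a seam point** — at `b₁.incl y₀ = D₁.jA a₁`,
`b₂.incl (φ y₀) = D₂.jA a₂`, every tangent frame `v₁` at `a₁` has a frame `uu` of `T_{y₀}` and a tangent
frame `v₂` at `a₂` with `d(b₁.incl) uu = d(D₁.jA) v₁` and `d(b₂.incl ∘ φ) uu = d(D₂.jA) v₂` (the frame
clauses of T3 (iv)). [cite: LeeSmoothManifolds2013, Thm. 5.11] -/
theorem helper_exists_seamFrames : ∀ (g : ℕ) (X₁ : Type) [TopologicalSpace X₁] [ChartedSpace (EuclideanHalfSpace 4) X₁] [IsManifold (𝓡∂ 4) ∞ X₁] (ι₁ : Type) [Finite ι₁] (q₁ : ι₁ → Literature.Topology.FourManifolds.HandleAttachingMap 3 2 (Literature.Topology.FourManifolds.LefschetzBase.Base g)) (W₂ : Type) [TopologicalSpace W₂] [ChartedSpace (EuclideanHalfSpace 4) W₂] [IsManifold (𝓡∂ 4) ∞ W₂] (ι₂ : Type) [Finite ι₂] (q₂ : ι₂ → Literature.Topology.FourManifolds.HandleAttachingMap 3 2 (Literature.Topology.FourManifolds.LefschetzBase.Base g)) (D₁ : Literature.Topology.FourManifolds.HandleAttachingMap.MultiAttachmentData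 q₁ (𝓡∂ 4) X₁) (b₁ : Literature.Topology.FourManifolds.BoundaryData (𝓡∂ 4) X₁ (𝓡 3)) (D₂ : Literature.Topology.FourManifolds.HandleAttachingMap.MultiAttachmentData q₂ (𝓡∂ 4) W₂) (b₂ : Literature.Topology.FourManifolds.BoundaryData (𝓡∂ 4) W₂ (𝓡 3)) (φ : b₁.carrier ≃ₘ⟮𝓡 3, 𝓡 3⟯ b₂.carrier) (y₀ : b₁.carrier) (a₁ : Literature.Topology.FourManifolds.HandleAttachingMap.coresComplement q₁) (a₂ : Literature.Topology.FourManifolds.HandleAttachingMap.coresComplement q₂) (v₁ : Fin 3 → EuclideanSpace ℝ (Fin 4)), b₁.incl y₀ = D₁.jA a₁ → b₂.incl (φ y₀) = D₂.jA a₂ → (∀ k, v₁ k 0 = 0) → ∃ (uu : Fin 3 → EuclideanSpace ℝ (Fin 3)) (v₂ : Fin 3 → EuclideanSpace ℝ (Fin 4)), (∀ k, mfderiv (𝓡 3) (𝓡∂ 4) b₁.incl y₀ (uu k) = mfderiv (𝓡∂ 4) (𝓡∂ 4) D₁.jA a₁ (v₁ k)) ∧ (∀ k, mfderiv (𝓡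 3) (𝓡∂ 4) (b₂.incl ∘ φ) y₀ (uu k) = mfderiv (𝓡∂ 4) (𝓡∂ 4) D₂.jA a₂ (v₂ k)) ∧ (∀ k, v₂ k 0 = 0) :=
  fun _ _ _ _ _ _ _ _ _ _ _ _ _ _ _ D₁ b₁ D₂ b₂ φ y₀ a₁ a₂ v₁ h₁ h₂ hv₁ =>
    exists_seamFrames D₁ b₁ D₂ b₂ φ y₀ a₁ a₂ h₁ h₂ v₁ hv₁

end Summit.SmoothPoincare4.SmoothPoincare4.Theorems.AcyclicBisectionExists.ModpBraidOrbits

end
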